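import Literature.NumberTheory.GaloisCohomology.LocalInvariantMapSubgroupInjective
import Literature.NumberTheory.ComplexMultiplication.EllipticUnits.ImaginaryQuadraticMainConjectureLocalTwistUntwist
import Literature.NumberTheory.GaloisRepresentations.ContinuousCohomologyConjTwistIndex
import Literature.NumberTheory.GaloisRepresentations.TateDualityDevissage
import HarnessLib

/-!
# (α3) ROW 1 — THE PER-LAYER LOCAL LAW behind `hplaces`: `4 · c = 0` when `θ′ ∋ −1` on the layer group, and
# `4 · (conj_δ c − u · c) = 0` in every case (`u = θ′(res_v δ) = ±1`)

Cell `bsd-print-cf2`, width seat `bsd-line-cf2-p1-w3` g20, lane (α3) ROW 1 of `stub_classGroupHalf` (DECIDING research child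
`PrintCf2RubinValueTwo.MainConjClauseAtSplitTwoQuadDA`, stmt-BirchSwinnertonDyer-24721 → class line 23300); `--supports` it `--as helper`,
Theses-free.  Consumer: the displayed hypothesis `hplaces` of `JLKDescent.classGroupRow_hfcoker`
(`Theorems/PrintCf2RubinValueTwoJLKDescentRowOneCokernel.lean`, cf2c-w8 g9), whose coefficient object is, VERBATIM,
`X := TopRep.res (locHom v) ((muTwist p θ′ k).quotientInvariants (ramificationSubgroup K 𝔖)).toTopRep` over a closed normal subgroup
`Λ ≤ Γ_{K_v}` of finite index (there: `Λ = φ_v⁻¹ V̄_n`).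

SETTING (generic): `K` a number field, `p` a prime, `θ′ : Γ_K → ℤ_p^×` continuous, `𝔖` a set of finite places with
`N_𝔖 ≤ ker (μ_{p^k} ⊗ θ′)` (`hμ`), `v` a finite place, `Λ ⊴ Γ_{K_v}` closed normal of finite index on which `θ′ ∘ res_v` takes only
the values `±1` (`hdich`; on the BSD cell's DA7 frame `θ′ = unitChar θ` with `θ² = 1`, so this holds everywhere).

* `four_smul_eq_zero_of_exists_apply_eq_neg_one` — **(C-ram)** if some `g₀ ∈ Λ` has `θ′(res_v g₀) = −1` then `4 · c = 0` for every
  `c ∈ H²(Λ, X)`.  Proof: inside the profinite group `↥Λ`, the subgroup `S₁ = (Λ ∩ ker θ′_v).subgroupOf Λ` has index `2`; over `S₁` the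
  twisted coefficients untwist (`λ = id` on carriers, an `S₁`-morphism, with the twist law `λ(g₀·w) = (θ′(g₀) mod p^k)·(g₀·λ w)`); the
  untwisted `H²(S₁, μ_{p^k}|)` is acted on TRIVIALLY by `g₀` (the local class field theory input,
  `conjMap_two_muAt_subgroupOf_eq_self` of `LocalInvariantMapSubgroupInjective.lean`, this seat); hence `conj_{g₀} = (p^k − 1)·` on
  `H²(S₁, X)` (`conjMap_two_eq_zsmul_of_twist`, cf2c-w8 g9), and `[Λ : S₁]·((1 − u)·c) = 0` (`index_smul_zsmul_eq_zero_of_conjMap_eq_zsmul`,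
  cf2c-w8 g9) with `p^k · c = 0` gives `2·(2·c) = 0`.
* `conjMap_two_eq_self_of_forall_apply_eq_one`, `conjMap_two_eq_neg_of_forall_apply_eq_one` — **(C-one)/(C-neg)** if `θ′ ∘ res_v` is
  trivial on `Λ`, then `conj_δ c = c` (resp. `= −c`) for `δ ∈ Γ_{K_v}` with `θ′(res_v δ) = 1` (resp. `−1`): cf2c-w8 g9's
  `conjMap_two_eq_zsmul_of_untwisted_trivial` with its input `hLI` DISCHARGED by `conjMap_two_muAt_eq_self` (this seat), and the scalar
  `(±1 mod p^k).val` normalised by `p^k · c = 0`.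
* `four_smul_conjMap_sub_eq_zero_of_apply_eq_one`, `four_smul_conjMap_add_eq_zero_of_apply_eq_neg_one` — **(C-pack)** for EVERY such `Λ`
  (no hypothesis on whether `θ′` is trivial on `Λ`): `4 · (conj_δ c − c) = 0` (resp. `4 · (conj_δ c + c) = 0`) — by cases on
  «`∃ g₀ ∈ Λ, θ′(res_v g₀) = −1`»: if yes, (C-ram) kills both terms; if no, (C-one)/(C-neg) are exact.  So the second disjunct of `hplaces`
  holds at every place where the pins decompose, with `e = 2`, uniformly in the layer `n` and the level `k` — no `n₀`, no member-type
  distinction, no index-`2` descent at small `n` is needed.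

RELATION TO cf2c-w8 g9's `…EllipticUnits/ImaginaryQuadraticMainConjectureLocalInputs.lean` (p741171, landed while this file was being
written; same two deliverables `four_smul_eq_zero_of_apply_eq_neg_one` / `two_smul_conjMap_sub_zsmul_eq_zero`): there the class-field-theory input
is the abelian-quotient descent `LocalTwoMuConjTrivial`, so the theorems carry `hk : 2 ≤ k`, the commutator hypothesis
`∀ x y, x*y*x⁻¹*y⁻¹ ∈ Λ` and the `k`-dependent scalar `(θ′(δ) mod p^k).val`; here the input is the general
`LocalInvariantMapSubgroupInjective` (every open normal `Λ`, every `k`), so NONE of these appear and the scalar is the fixed `u = ±1`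
that `hplaces` quantifies BEFORE `n, k` (`e = 2` uniformly, no `k ≤ 1` split).

THEOREMS ONLY (no definition, no named fact, no instance, no `sorry`); private arithmetic helpers.  HONEST FRAMING: bookkeeping over
local class field theory; no summit statement is proved by this seat; BSD is not proved by any of this.

References: J. Johnson-Leung, G. Kings, J. reine angew. Math. 653 (2011) §5.4 Lemma 5.8 [JohnsonLeungKings2011]; J.-P. Serre,
*Local Fields* (1979) VII §5 Prop. 3, XIII §3 Prop. 7 [SerreLocalFields1979]; Neukirch–Schmidt–Wingberg (2008) (7.1.4) [NeukirchSchmidtWingberg2008].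
-/

noncomputable section

set_option linter.dupNamespace false -- D-0017: single-problem summit, `…BirchSwinnertonDyer.BirchSwinnertonDyer…` repeats a namespace by design
set_option autoImplicit false

open scoped NumberField
open CategoryTheory Function Field IsDedekindDomain NumberField
open Literature.NumberTheory.GaloisRepresentations
open Literature.NumberTheory.GaloisRepresentations.DiscreteGaloisModule
open Literature.NumberTheory.GaloisCohomology (muAt conjMap_two_muAt_eq_self conjMap_two_muAt_subgroupOf_eq_self)
open Literature.NumberTheory.GaloisCohomology.ShaLayer (locHom)
open Literature.NumberTheory.ComplexMultiplication.EllipticUnits.JohnsonLeungKings2011 (muTwist charModPow charModPow_apply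
  muTwist_apply_of_apply_eq_one)
open Literature.NumberTheory.ComplexMultiplication.EllipticUnits.JohnsonLeungKings2011.ClassGroupRow
open _root_.TopRep _root_.ContinuousCohomology

namespace Summit.BirchSwinnertonDyer.BirchSwinnertonDyer.Theorems.PrintCf2.RowOneLocalLaw

attribute [local instance] absoluteGaloisGroup_compactSpace compactSpace_of_isClosed_subgroup isClosed_subgroupOf_of_isClosed

variable {K : Type} [Field K] [NumberField K] (p : ℕ) [Fact p.Prime] (θ' : absoluteGaloisGroup K →ₜ* ℤ_[p]ˣ)
  (𝔖 : Set (HeightOneSpectrum (𝓞 K))) (k : ℕ) (v : HeightOneSpectrum (𝓞 K))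
  (Λ : Subgroup (absoluteGaloisGroup (v.adicCompletion K)))
  [IsClosed (Λ : Set (absoluteGaloisGroup (v.adicCompletion K)))]
  [Fintype (absoluteGaloisGroup (v.adicCompletion K) ⧸ Λ)] [Λ.Normal]

/-! ## §1 Arithmetic helpers -/

/-- `((-1 : ℤ/m).val : ℤ) + 1 = m` for `m ≠ 0`. [folklore] -/
private theorem val_neg_one_add_one {m : ℕ} (hm : m ≠ 0) : (((-1 : ZMod m).val : ℕ) : ℤ) + 1 = m := by
  obtain ⟨n, rfl⟩ := Nat.exists_eq_succ_of_ne_zero hm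
  rw [ZMod.val_neg_one]
  push_cast
  ring

omit [NumberField K] in
/-- `θ′ σ = −1 ⟹ (θ′ σ mod p^k).val + 1 = p^k` (in `ℤ`). [folklore] -/
private theorem charModPow_val_add_one_of_apply_eq_neg_one {σ : absoluteGaloisGroup K} (hσ : θ' σ = -1) :
    (((charModPow p θ' k σ).val : ℕ) : ℤ) + 1 = ((p ^ k : ℕ) : ℤ) := by
  have h1 : charModPow p θ' k σ = -1 := by
    rw [charModPow_apply, hσ, Units.val_neg, Units.val_one, map_neg, map_one]
  rw [h1]
  exact val_neg_one_add_one (pow_ne_zero k (Fact.out : p.Prime).ne_zero)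

omit [NumberField K] in
/-- `θ′ σ = 1 ⟹ (θ′ σ mod p^k).val = 1 % p^k`. [folklore] -/
private theorem charModPow_val_of_apply_eq_one {σ : absoluteGaloisGroup K} (hσ : θ' σ = 1) :
    (charModPow p θ' k σ).val = 1 % p ^ k := by
  rw [charModPow_apply, hσ, Units.val_one, map_one, ZMod.val_one_eq_one_mod]

omit [NumberField K] in
/-- `μ_n(K̄)` is killed by `n`. [folklore] -/
private theorem muCarrier_nsmul_eq_zero (n : ℕ) (ζ : MuCarrier K n) : n • ζ = 0 :=
  muVal_injective K n (by rw [muVal_nsmul, muVal_pow_eq_one, muVal_zero])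

/-- `−1 ≠ 1` in `ℤ_p^×`. [folklore] -/
private theorem neg_one_ne_one_padicIntUnits : (-1 : ℤ_[p]ˣ) ≠ 1 := by
  intro h
  have h' : ((-1 : ℤ_[p]ˣ) : ℤ_[p]) = ((1 : ℤ_[p]ˣ) : ℤ_[p]) := congrArg Units.val h
  rw [Units.val_neg, Units.val_one] at h'
  have h2 : (1 : ℤ_[p]) + 1 = 0 := eq_neg_iff_add_eq_zero.mp h'.symm
  rw [one_add_one_eq_two] at h2
  exact two_ne_zero h2

/-! ## §2 (C-ram): `θ′ ∋ −1` on `Λ` ⟹ `4 · H²(Λ, X) = 0` -/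

/-- **(C-ram) `4 · c = 0` on `H²(Λ, (μ_{p^k} ⊗ θ′)^{N_𝔖}|)` when some `g₀ ∈ Λ` has `θ′(res_v g₀) = −1`** (`Λ ⊴ Γ_{K_v}` closed normal of finite
index on which `θ′ ∘ res_v = ±1`, `N_𝔖 ≤ ker(μ_{p^k} ⊗ θ′)`): inside `↥Λ`, over the index-`2` subgroup `S₁ = Λ ∩ ker θ′_v` the coefficients
untwist and `g₀` acts trivially on `H²(S₁, μ_{p^k}|)` (local class field theory, `conjMap_two_muAt_subgroupOf_eq_self`), so
`conj_{g₀} = (−1 mod p^k)·` on `H²(S₁, X)` (`conjMap_two_eq_zsmul_of_twist`) and `2·((1 − (p^k−1))·c) = 0`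
(`index_smul_zsmul_eq_zero_of_conjMap_eq_zsmul`), i.e. `4c = 0` as `p^k c = 0` — the first disjunct of `hplaces` with `e = 2` at `p = 2`.
[cite: JohnsonLeungKings2011, §5.4 Lemma 5.8 (proof)] [cite: SerreLocalFields1979, VII §5 Prop. 3, XIII §3 Prop. 7] -/
theorem four_smul_eq_zero_of_exists_apply_eq_neg_one (hμ : ramificationSubgroup K 𝔖 ≤ ContinuousRep.ker (muTwist p θ' k))
    (hdich : ∀ s ∈ Λ, θ' (absGaloisRestrict K (v.adicCompletion K) s) = 1 ∨ θ' (absGaloisRestrict K (v.adicCompletion K) s) = -1)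
    (hg₀ : ∃ g₀ ∈ Λ, θ' (absGaloisRestrict K (v.adicCompletion K) g₀) = -1)
    (c : continuousCohomology 2 (subgroupRep (TopRep.res (locHom (S := 𝔖) v : absoluteGaloisGroup (v.adicCompletion K) →*
        GaloisGroupUnramifiedOutside K 𝔖) ((muTwist p θ' k).quotientInvariants (ramificationSubgroup K 𝔖)).toTopRep) Λ)) :
    4 • c = 0 := by
  classical
  haveI : NeZero (p ^ k) := ⟨pow_ne_zero k (Fact.out : p.Prime).ne_zero⟩
  obtain ⟨g₀, hg₀Λ, hg₀⟩ := hg₀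
  -- the local character `θ′_v = θ′ ∘ res_v` and `T = Λ ∩ ker θ′_v`
  let θv : absoluteGaloisGroup (v.adicCompletion K) →* ℤ_[p]ˣ :=
    (θ' : absoluteGaloisGroup K →* ℤ_[p]ˣ).comp (absGaloisRestrict K (v.adicCompletion K) : absoluteGaloisGroup (v.adicCompletion K) →*
      absoluteGaloisGroup K)
  have hθv : ∀ s, θv s = θ' (absGaloisRestrict K (v.adicCompletion K) s) := fun _ => rfl
  have hθvc : Continuous θv := θ'.continuous.comp (absGaloisRestrict K (v.adicCompletion K)).continuous
  let T : Subgroup (absoluteGaloisGroup (v.adicCompletion K)) := Λ ⊓ θv.ker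
  have hTΛ : T ≤ Λ := inf_le_left
  haveI hTc : IsClosed (T : Set (absoluteGaloisGroup (v.adicCompletion K))) := by
    change IsClosed ((Λ : Set (absoluteGaloisGroup (v.adicCompletion K))) ∩
      ((θv.ker : Subgroup (absoluteGaloisGroup (v.adicCompletion K))) : Set (absoluteGaloisGroup (v.adicCompletion K))))
    exact IsClosed.inter ‹_› ((isClosed_singleton (x := (1 : ℤ_[p]ˣ))).preimage hθvc)
  haveI : T.Normal := Subgroup.normal_inf_normal Λ θv.ker
  -- `S₁ = T.subgroupOf Λ` is the kernel of `θ′_v|_Λ`, of index `2`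
  let f : Λ →* ℤ_[p]ˣ := θv.comp Λ.subtype
  have hS₁f : T.subgroupOf Λ = f.ker := by
    ext x
    rw [Subgroup.mem_subgroupOf, MonoidHom.mem_ker]
    change (x : absoluteGaloisGroup (v.adicCompletion K)) ∈ Λ ⊓ θv.ker ↔ θv x = 1
    rw [Subgroup.mem_inf, MonoidHom.mem_ker]
    exact ⟨fun h => h.2, fun h => ⟨x.2, h⟩⟩
  have hneg : (-1 : ℤ_[p]ˣ) ≠ 1 := neg_one_ne_one_padicIntUnits p
  have hrange : (f.range : Set ℤ_[p]ˣ) = {1, -1} := by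
    ext u
    simp only [SetLike.mem_coe, MonoidHom.mem_range, Set.mem_insert_iff, Set.mem_singleton_iff]
    constructor
    · rintro ⟨x, rfl⟩
      exact hdich x.1 x.2
    · rintro (rfl | rfl)
      · exact ⟨1, map_one f⟩
      · exact ⟨⟨g₀, hg₀Λ⟩, hg₀⟩
  have hidx : (T.subgroupOf Λ).index = 2 := by
    rw [hS₁f, Subgroup.index_ker, ← SetLike.coe_sort_coe, hrange, Nat.card_coe_set_eq, Set.ncard_pair hneg.symm]
  haveI : (T.subgroupOf Λ).FiniteIndex := ⟨by rw [hidx]; decide⟩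
  haveI : Fintype (Λ ⧸ T.subgroupOf Λ) := Subgroup.fintypeOfIndexNeZero (by rw [hidx]; decide)
  have hTidx : T.index ≠ 0 := by
    rw [← Subgroup.relIndex_mul_index hTΛ, Subgroup.relIndex, hidx]
    exact mul_ne_zero two_ne_zero Subgroup.index_ne_zero_of_finite
  haveI : Fintype (absoluteGaloisGroup (v.adicCompletion K) ⧸ T) := Subgroup.fintypeOfIndexNeZero hTidx
  have hS₁open : IsOpen ((T.subgroupOf Λ : Subgroup Λ) : Set Λ) :=
    Subgroup.isOpen_of_isClosed_of_finiteIndex _ (isClosed_subgroupOf_of_isClosed Λ T)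
  -- the representations of `↥Λ`
  let Q := (muTwist p θ' k).quotientInvariants (ramificationSubgroup K 𝔖)
  let ρΛ : ContinuousRep Λ ℤ ((muTwist p θ' k).invariantsOf (ramificationSubgroup K 𝔖)) :=
    (Q.restrict (locHom (S := 𝔖) v)).restrict (subgroupIncl Λ)
  let X' : TopRep ℤ Λ := ((muAt K (p ^ k) v).restrict (subgroupIncl Λ)).toTopRep
  -- read `c` in `H²(↥Λ, ρΛ)` (the same group, syntactically re-typed)
  obtain ⟨c, rfl⟩ : ∃ c' : continuousCohomology 2 ρΛ.toTopRep, c' = c := ⟨c, rfl⟩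
  -- untwisting over `S₁` inside `↥Λ`
  have hT1 : ∀ s : (T.subgroupOf Λ : Subgroup Λ), θ' (absGaloisRestrict K (v.adicCompletion K) ((s : Λ) : absoluteGaloisGroup (v.adicCompletion K))) = 1 :=
    fun s => by
      have hs : ((s : Λ) : absoluteGaloisGroup (v.adicCompletion K)) ∈ T := s.2
      exact hs.2
  have hmem : ∀ x : MuCarrier K (p ^ k), x ∈ (muTwist p θ' k).invariantsOf (ramificationSubgroup K 𝔖) := fun x =>
    Literature.NumberTheory.GaloisCohomology.ShaLayer.mem_invariants_of_le_ker 𝔖 (muTwist p θ' k) hμ x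
  let lam : subgroupRep ρΛ.toTopRep (T.subgroupOf Λ) ⟶ subgroupRep X' (T.subgroupOf Λ) := TopRep.ofHom
    { toLinearMap := ((muTwist p θ' k).invariantsOf (ramificationSubgroup K 𝔖)).subtype.toAddMonoidHom.toIntLinearMap
      cont := continuous_of_discreteTopology
      isIntertwining' := fun s => by
        ext w
        change ((muTwist p θ' k) (absGaloisRestrict K (v.adicCompletion K) ((s : Λ) : absoluteGaloisGroup (v.adicCompletion K)))
            (w : MuCarrier K (p ^ k))) =
          mu K (p ^ k) (absGaloisRestrict K (v.adicCompletion K) ((s : Λ) : absoluteGaloisGroup (v.adicCompletion K))) (w : MuCarrier K (p ^ k))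
        exact muTwist_apply_of_apply_eq_one p θ' k (hT1 s) _ }
  let inv : subgroupRep X' (T.subgroupOf Λ) ⟶ subgroupRep ρΛ.toTopRep (T.subgroupOf Λ) := TopRep.ofHom
    { toLinearMap := (LinearMap.codRestrict ((muTwist p θ' k).invariantsOf (ramificationSubgroup K 𝔖)) LinearMap.id hmem)
      cont := continuous_of_discreteTopology
      isIntertwining' := fun s => by
        ext x
        change mu K (p ^ k) (absGaloisRestrict K (v.adicCompletion K) ((s : Λ) : absoluteGaloisGroup (v.adicCompletion K))) x =
          (muTwist p θ' k) (absGaloisRestrict K (v.adicCompletion K) ((s : Λ) : absoluteGaloisGroup (v.adicCompletion K))) x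
        exact (muTwist_apply_of_apply_eq_one p θ' k (hT1 s) _).symm }
  have hinj : Function.Injective (cohomologyMap lam 2) :=
    cohomologyMap_injective_of_leftInverse lam inv fun a => Subtype.ext rfl
  -- `g₀` acts trivially on the untwisted `H²(S₁, μ_{p^k}|)` (local class field theory) ⟹ as `(−1 mod p^k)·` on `H²(S₁, X)`
  have hconj : ∀ w : continuousCohomology 2 (subgroupRep ρΛ.toTopRep (T.subgroupOf Λ)),
      conjMap ρΛ.toTopRep (T.subgroupOf Λ) ⟨g₀, hg₀Λ⟩ 2 w =
        ((charModPow p θ' k (absGaloisRestrict K (v.adicCompletion K) g₀)).val : ℤ) • w := fun w =>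
    conjMap_two_eq_zsmul_of_twist ρΛ.toTopRep X' (T.subgroupOf Λ) lam ⟨g₀, hg₀Λ⟩ _ (fun _ => rfl) hinj
      (fun z => conjMap_two_muAt_subgroupOf_eq_self K (p ^ k) v Λ T hTΛ ⟨g₀, hg₀Λ⟩ z) w
  -- the index kill inside `↥Λ`
  have hkill := index_smul_zsmul_eq_zero_of_conjMap_eq_zsmul ρΛ (T.subgroupOf Λ) hS₁open ⟨g₀, hg₀Λ⟩ _ hconj c
  rw [hidx] at hkill
  -- arithmetic: `p^k c = 0` (read in `H²(↥Λ, ρΛ)`), `(val + 1) = p^k`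
  have hpk : (p ^ k) • c = 0 :=
    nsmul_continuousCohomology_two_eq_zero ρΛ.toTopRep (p ^ k)
      (fun x => Subtype.ext (muCarrier_nsmul_eq_zero (p ^ k) (x : MuCarrier K (p ^ k)))) c
  have hval : (((charModPow p θ' k (absGaloisRestrict K (v.adicCompletion K) g₀)).val : ℕ) : ℤ) + 1 = ((p ^ k : ℕ) : ℤ) :=
    charModPow_val_add_one_of_apply_eq_neg_one p θ' k hg₀
  -- `(1 − u) = 2 − p^k` for `u = (θ′(g₀) mod p^k).val`, then `p^k • c = 0`
  have h1u : (1 : ℤ) - (((charModPow p θ' k (absGaloisRestrict K (v.adicCompletion K) g₀)).val : ℕ) : ℤ) =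
      2 - ((p ^ k : ℕ) : ℤ) := by linarith
  rw [h1u, sub_zsmul, natCast_zsmul, hpk, neg_zero, add_zero, two_zsmul, ← two_nsmul] at hkill
  rw [show (4 : ℕ) = 2 * 2 from rfl, mul_nsmul]
  exact hkill

/-! ## §3 (C-one)/(C-neg): `θ′ ∘ res_v` trivial on `Λ` ⟹ `conj_δ = θ′(res_v δ)` exactly -/

/-- **(C-one)** if `θ′ ∘ res_v` is trivial on `Λ` and `θ′(res_v δ) = 1`, then `conj_δ c = c` on `H²(Λ, (μ_{p^k} ⊗ θ′)^{N_𝔖}|)`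
(cf2c-w8 g9's `conjMap_two_eq_zsmul_of_untwisted_trivial` with the class-field-theory input `conjMap_two_muAt_eq_self` supplied, and the
scalar `(1 mod p^k).val` normalised by `p^k c = 0`). [cite: JohnsonLeungKings2011, §5.4 Lemma 5.8 (proof)] [cite: SerreLocalFields1979, VII §5 Prop. 3] -/
theorem conjMap_two_eq_self_of_forall_apply_eq_one (hμ : ramificationSubgroup K 𝔖 ≤ ContinuousRep.ker (muTwist p θ' k))
    (hΛ : ∀ s ∈ Λ, θ' (absGaloisRestrict K (v.adicCompletion K) s) = 1) (δ : absoluteGaloisGroup (v.adicCompletion K))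
    (hδ : θ' (absGaloisRestrict K (v.adicCompletion K) δ) = 1)
    (c : continuousCohomology 2 (subgroupRep (TopRep.res (locHom (S := 𝔖) v : absoluteGaloisGroup (v.adicCompletion K) →*
        GaloisGroupUnramifiedOutside K 𝔖) ((muTwist p θ' k).quotientInvariants (ramificationSubgroup K 𝔖)).toTopRep) Λ)) :
    conjMap (TopRep.res (locHom (S := 𝔖) v : absoluteGaloisGroup (v.adicCompletion K) →* GaloisGroupUnramifiedOutside K 𝔖)
        ((muTwist p θ' k).quotientInvariants (ramificationSubgroup K 𝔖)).toTopRep) Λ δ 2 c = c := by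
  haveI : NeZero (p ^ k) := ⟨pow_ne_zero k (Fact.out : p.Prime).ne_zero⟩
  have hpk : (p ^ k) • c = 0 :=
    nsmul_continuousCohomology_two_eq_zero _ (p ^ k) (fun x => Subtype.ext (muCarrier_nsmul_eq_zero (p ^ k) (x : MuCarrier K (p ^ k)))) c
  have hLI : ∀ z : continuousCohomology 2 (subgroupRep ((mu K (p ^ k)).restrict
      (absGaloisRestrict K (v.adicCompletion K))).toTopRep Λ),
      conjMap ((mu K (p ^ k)).restrict (absGaloisRestrict K (v.adicCompletion K))).toTopRep Λ δ 2 z = z :=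
    fun z => conjMap_two_muAt_eq_self K (p ^ k) v Λ δ z
  have key := conjMap_two_eq_zsmul_of_untwisted_trivial p θ' 𝔖 k v Λ hμ hΛ δ hLI c
  rw [key, charModPow_val_of_apply_eq_one p θ' k hδ]
  rcases Nat.lt_or_ge 1 (p ^ k) with hlt | hle
  · rw [Nat.mod_eq_of_lt hlt, Nat.cast_one, one_zsmul]
  · have hpk1 : p ^ k = 1 := le_antisymm hle (Nat.one_le_pow _ _ (Fact.out : p.Prime).pos)
    have hc0 : c = 0 := by
      have h := congrArg (fun n : ℕ => n • c) hpk1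
      rw [one_nsmul] at h
      exact h.symm.trans hpk
    have h0 : 1 % p ^ k = 0 := by rw [hpk1]
    rw [h0, Nat.cast_zero, zero_zsmul]
    exact hc0.symm

/-- **(C-neg)** if `θ′ ∘ res_v` is trivial on `Λ` and `θ′(res_v δ) = −1`, then `conj_δ c = −c` on `H²(Λ, (μ_{p^k} ⊗ θ′)^{N_𝔖}|)`.
[cite: JohnsonLeungKings2011, §5.4 Lemma 5.8 (proof)] [cite: SerreLocalFields1979, VII §5 Prop. 3] -/
theorem conjMap_two_eq_neg_of_forall_apply_eq_one (hμ : ramificationSubgroup K 𝔖 ≤ ContinuousRep.ker (muTwist p θ' k))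
    (hΛ : ∀ s ∈ Λ, θ' (absGaloisRestrict K (v.adicCompletion K) s) = 1) (δ : absoluteGaloisGroup (v.adicCompletion K))
    (hδ : θ' (absGaloisRestrict K (v.adicCompletion K) δ) = -1)
    (c : continuousCohomology 2 (subgroupRep (TopRep.res (locHom (S := 𝔖) v : absoluteGaloisGroup (v.adicCompletion K) →*
        GaloisGroupUnramifiedOutside K 𝔖) ((muTwist p θ' k).quotientInvariants (ramificationSubgroup K 𝔖)).toTopRep) Λ)) :
    conjMap (TopRep.res (locHom (S := 𝔖) v : absoluteGaloisGroup (v.adicCompletion K) →* GaloisGroupUnramifiedOutside K 𝔖)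
        ((muTwist p θ' k).quotientInvariants (ramificationSubgroup K 𝔖)).toTopRep) Λ δ 2 c = -c := by
  haveI : NeZero (p ^ k) := ⟨pow_ne_zero k (Fact.out : p.Prime).ne_zero⟩
  have hpk : (p ^ k) • c = 0 :=
    nsmul_continuousCohomology_two_eq_zero _ (p ^ k) (fun x => Subtype.ext (muCarrier_nsmul_eq_zero (p ^ k) (x : MuCarrier K (p ^ k)))) c
  have hLI : ∀ z : continuousCohomology 2 (subgroupRep ((mu K (p ^ k)).restrict
      (absGaloisRestrict K (v.adicCompletion K))).toTopRep Λ),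
      conjMap ((mu K (p ^ k)).restrict (absGaloisRestrict K (v.adicCompletion K))).toTopRep Λ δ 2 z = z :=
    fun z => conjMap_two_muAt_eq_self K (p ^ k) v Λ δ z
  have key := conjMap_two_eq_zsmul_of_untwisted_trivial p θ' 𝔖 k v Λ hμ hΛ δ hLI c
  rw [key]
  have hval : (((charModPow p θ' k (absGaloisRestrict K (v.adicCompletion K) δ)).val : ℕ) : ℤ) = ((p ^ k : ℕ) : ℤ) - 1 := by
    rw [← charModPow_val_add_one_of_apply_eq_neg_one p θ' k hδ]; ring
  rw [hval, sub_zsmul, one_zsmul, natCast_zsmul, hpk, zero_add]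

/-! ## §4 (C-pack): the uniform law `4 · (conj_δ c − u · c) = 0`, `u = θ′(res_v δ) = ±1` -/

/-- **(C-pack, `u = 1`)** for EVERY closed normal `Λ` of finite index on which `θ′ ∘ res_v = ±1` and every `δ` with `θ′(res_v δ) = 1`:
`4 · (conj_δ c − 1 · c) = 0` on `H²(Λ, (μ_{p^k} ⊗ θ′)^{N_𝔖}|)` — by cases: some `g₀ ∈ Λ` with `θ′ = −1` (then `4c = 0 = 4·conj_δ c`,
(C-ram)) or `θ′` trivial on `Λ` ((C-one), exact).  The `hplaces` second disjunct at a decomposed pin, `e = 2`, uniformly in `n, k`.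
[cite: JohnsonLeungKings2011, §5.4 Lemma 5.8 (proof)] [cite: NeukirchSchmidtWingberg2008, (7.1.4)] -/
theorem four_smul_conjMap_sub_eq_zero_of_apply_eq_one (hμ : ramificationSubgroup K 𝔖 ≤ ContinuousRep.ker (muTwist p θ' k))
    (hdich : ∀ s ∈ Λ, θ' (absGaloisRestrict K (v.adicCompletion K) s) = 1 ∨ θ' (absGaloisRestrict K (v.adicCompletion K) s) = -1)
    (δ : absoluteGaloisGroup (v.adicCompletion K)) (hδ : θ' (absGaloisRestrict K (v.adicCompletion K) δ) = 1)
    (c : continuousCohomology 2 (subgroupRep (TopRep.res (locHom (S := 𝔖) v : absoluteGaloisGroup (v.adicCompletion K) →*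
        GaloisGroupUnramifiedOutside K 𝔖) ((muTwist p θ' k).quotientInvariants (ramificationSubgroup K 𝔖)).toTopRep) Λ)) :
    4 • (conjMap (TopRep.res (locHom (S := 𝔖) v : absoluteGaloisGroup (v.adicCompletion K) →* GaloisGroupUnramifiedOutside K 𝔖)
        ((muTwist p θ' k).quotientInvariants (ramificationSubgroup K 𝔖)).toTopRep) Λ δ 2 c - (1 : ℤ) • c) = 0 := by
  by_cases h : ∃ g₀ ∈ Λ, θ' (absGaloisRestrict K (v.adicCompletion K) g₀) = -1
  · have h4 := four_smul_eq_zero_of_exists_apply_eq_neg_one p θ' 𝔖 k v Λ hμ hdich h c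
    rw [one_zsmul, nsmul_sub, ← map_nsmul, h4, map_zero, sub_zero]
  · have hΛ : ∀ s ∈ Λ, θ' (absGaloisRestrict K (v.adicCompletion K) s) = 1 := fun s hs =>
      (hdich s hs).resolve_right fun hs' => h ⟨s, hs, hs'⟩
    rw [conjMap_two_eq_self_of_forall_apply_eq_one p θ' 𝔖 k v Λ hμ hΛ δ hδ c, one_zsmul, sub_self, nsmul_zero]

/-- **(C-pack, `u = −1`)** as `four_smul_conjMap_sub_eq_zero_of_apply_eq_one`, for `θ′(res_v δ) = −1`:
`4 · (conj_δ c − (−1) · c) = 0`. [cite: JohnsonLeungKings2011, §5.4 Lemma 5.8 (proof)] [cite: NeukirchSchmidtWingberg2008, (7.1.4)] -/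
theorem four_smul_conjMap_sub_eq_zero_of_apply_eq_neg_one (hμ : ramificationSubgroup K 𝔖 ≤ ContinuousRep.ker (muTwist p θ' k))
    (hdich : ∀ s ∈ Λ, θ' (absGaloisRestrict K (v.adicCompletion K) s) = 1 ∨ θ' (absGaloisRestrict K (v.adicCompletion K) s) = -1)
    (δ : absoluteGaloisGroup (v.adicCompletion K)) (hδ : θ' (absGaloisRestrict K (v.adicCompletion K) δ) = -1)
    (c : continuousCohomology 2 (subgroupRep (TopRep.res (locHom (S := 𝔖) v : absoluteGaloisGroup (v.adicCompletion K) →*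
        GaloisGroupUnramifiedOutside K 𝔖) ((muTwist p θ' k).quotientInvariants (ramificationSubgroup K 𝔖)).toTopRep) Λ)) :
    4 • (conjMap (TopRep.res (locHom (S := 𝔖) v : absoluteGaloisGroup (v.adicCompletion K) →* GaloisGroupUnramifiedOutside K 𝔖)
        ((muTwist p θ' k).quotientInvariants (ramificationSubgroup K 𝔖)).toTopRep) Λ δ 2 c - (-1 : ℤ) • c) = 0 := by
  by_cases h : ∃ g₀ ∈ Λ, θ' (absGaloisRestrict K (v.adicCompletion K) g₀) = -1
  · have h4 := four_smul_eq_zero_of_exists_apply_eq_neg_one p θ' 𝔖 k v Λ hμ hdich h c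
    rw [neg_one_zsmul, sub_neg_eq_add, nsmul_add, ← map_nsmul, h4, map_zero, add_zero]
  · have hΛ : ∀ s ∈ Λ, θ' (absGaloisRestrict K (v.adicCompletion K) s) = 1 := fun s hs =>
      (hdich s hs).resolve_right fun hs' => h ⟨s, hs, hs'⟩
    rw [conjMap_two_eq_neg_of_forall_apply_eq_one p θ' 𝔖 k v Λ hμ hΛ δ hδ c, neg_one_zsmul, sub_self, nsmul_zero]

end Summit.BirchSwinnertonDyer.BirchSwinnertonDyer.Theorems.PrintCf2.RowOneLocalLaw

end
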